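import Mathlib
import Literature.Geometry.DiscreteGeometry.DelaunaySubdivision
import Literature.Geometry.DiscreteGeometry.SolidAngleFraction
import Summits.AtomisticToContinuum.Crystallization.Theorems.ReggeStarCoercivityDihedralFlatness
import HarnessLib

/-!
# Stub `stub_edgeFlat` of line `Sketch` (idea par-five-delaunay-recount) of crux
`SquareWellLayerCake.AveragedTwelve` (stmt-AtomisticToContinuum-15806)

DIHEDRAL PARTITION OF UNITY IN COMPLEX FORM.  `K` triangulates the finite site set `ω ⊂ ℝ³`
(`Literature.Geometry.DiscreteGeometry.IsTriangulation`), `v` is a site interior to `conv ω`,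
`{v, z}` is an edge of `K`, and `S` is the set of cells of `K` (simplices with `4` vertices)
containing `v` and `z` (the edge star `edgeStar K v z`, `finrank ℝ ℝ³ + 1 = 4`).  Claim: the
unit-ball volume fractions at `v` of the dihedral wedges of those cells along `vz` sum to `1`
(the dihedral angles around an interior edge sum to `2π`).

PROOF (plumbing of the landed item `DihedralFlatness`,
`Summit.AtomisticToContinuum.Crystallization.Theorems.dihedralFlatness_proof`):
* enumerate `S ≃ Fin n` and, for each cell `t ∈ S`, the two remaining vertices
  `(t ∖ {v}) ∖ {z} ≃ Fin 2` (its cardinality is `4 − 2 = 2`), giving `p k : Fin 2 → ℝ³` with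
  `{v, z} ∪ range (p k) = t_k`; reindexing the generators of a wedge along an equivalence does
  not change the wedge (`apexWedge_comp_equiv`), so the summands are literally those of
  `DihedralFlatness` (`ballFraction v (apexWedge v (z − v) (p k · − v))`, by `rfl`);
* the hypotheses of `DihedralFlatness`: linear independence of `z − v, p k 0 − v, p k 1 − v`
  from the affine independence of the vertices of a simplex
  (`linearIndependent_sub_of_mem_faces`); disjoint interiors of distinct cells
  (`disjoint_interior_convexHull`); and the covering of a ball about the midpoint of `vz` by
  the cells of the edge star (`IsTriangulation.exists_ball_subset_biUnion_edgeStar`), the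
  midpoint being interior to `conv ω` because `v` is and `z ∈ conv ω`
  (`Convex.openSegment_interior_self_subset_interior`).
-/

noncomputable section

namespace Summit.AtomisticToContinuum.Crystallization.Theorems.ParFiveRecountEdgeFlat

open Literature.Geometry.DiscreteGeometry
open MeasureTheory Metric Set

/-- Reindexing the generators of a wedge along an equivalence does not change the wedge.
[folklore] -/
theorem apexWedge_comp_equiv {V : Type*} [AddCommGroup V] [Module ℝ V] {ι κ : Type*}
    [Fintype ι] [Fintype κ] (v d : V) (u : κ → V) (e : ι ≃ κ) :
    apexWedge v d (u ∘ e) = apexWedge v d u := by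
  ext q
  simp only [mem_apexWedge_iff, Function.comp_apply]
  constructor
  · rintro ⟨s, c, hc, rfl⟩
    refine ⟨s, c ∘ e.symm, fun j => hc _, ?_⟩
    rw [← e.sum_comp (fun j => (c ∘ e.symm) j • u j)]
    simp
  · rintro ⟨s, c, hc, rfl⟩
    exact ⟨s, c ∘ e, fun i => hc _, by rw [← e.sum_comp (fun j => c j • u j)]; rfl⟩

/-- The three edge vectors at `v` of a simplex `t ∋ v` of a geometric simplicial complex, listed
as `z − v, a − v, b − v` for three further distinct vertices `z, a, b`, are linearly independent.
[folklore] -/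
theorem linearIndependent_edge_vectors {V : Type*} [NormedAddCommGroup V] [NormedSpace ℝ V]
    [DecidableEq V] {K : Geometry.SimplicialComplex ℝ V} {t : Finset V} (ht : t ∈ K.faces)
    {v z a b : V} (hv : v ∈ t) (hz : z ∈ t.erase v) (ha : a ∈ (t.erase v).erase z)
    (hb : b ∈ (t.erase v).erase z) (hab : a ≠ b) :
    LinearIndependent ℝ ![z - v, a - v, b - v] := by
  have h := linearIndependent_sub_of_mem_faces ht hv
  have ha' : a ∈ t.erase v := Finset.mem_of_mem_erase ha
  have hb' : b ∈ t.erase v := Finset.mem_of_mem_erase hb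
  have haz : a ≠ z := Finset.ne_of_mem_erase ha
  have hbz : b ≠ z := Finset.ne_of_mem_erase hb
  let f : Fin 3 → ↥(t.erase v) := ![⟨z, hz⟩, ⟨a, ha'⟩, ⟨b, hb'⟩]
  have hf : Function.Injective f := by
    intro i j hij
    fin_cases i <;> fin_cases j <;> simp_all [f]
  have hcomp : (fun q : ↥(t.erase v) => (q : V) - v) ∘ f = ![z - v, a - v, b - v] := by
    funext i
    fin_cases i <;> rfl
  have key := h.comp f hf
  rw [hcomp] at key
  exact key

/-- **`stub_edgeFlat`**: around an interior edge `vz` of a triangulation of a finite site set in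
`ℝ³`, the dihedral-angle volume fractions at `v` of the cells containing `v` and `z` sum to `1`. -/
theorem stub_edgeFlat : ∀ (ω : Finset (EuclideanSpace ℝ (Fin 3))) (K : Geometry.SimplicialComplex ℝ (EuclideanSpace ℝ (Fin 3))), Literature.Geometry.DiscreteGeometry.IsTriangulation (↑ω : Set (EuclideanSpace ℝ (Fin 3))) K → ∀ v ∈ ω, v ∈ interior (convexHull ℝ (↑ω : Set (EuclideanSpace ℝ (Fin 3)))) → ∀ (z : EuclideanSpace ℝ (Fin 3)), z ≠ v → ({v, z} : Finset (EuclideanSpace ℝ (Fin 3))) ∈ K.faces → ∀ (S : Finset (Finset (EuclideanSpace ℝ (Fin 3)))), (∀ t, t ∈ S ↔ t ∈ K.faces ∧ v ∈ t ∧ z ∈ t ∧ t.card = 4) → ∑ t ∈ S, Literature.Geometry.DiscreteGeometry.ballFraction v (Literature.Geometry.DiscreteGeometry.apexWedge v (z - v) (fun w : ↥(((t).erase v).erase z) => (↑w : EuclideanSpace ℝ (Fin 3)) - v)) = 1 := by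
  intro ω K hK v hv hvint z hzv hvz S hS
  -- the summand, as a function of the cell
  set F : Finset (EuclideanSpace ℝ (Fin 3)) → ℝ := fun t =>
    ballFraction v
      (apexWedge v (z - v) (fun w : ↥((t.erase v).erase z) => (w : EuclideanSpace ℝ (Fin 3)) - v))
    with hF
  -- `z` is a site, and the midpoint of `vz` is interior to `conv ω`
  have hzω : z ∈ ω := hK.mem_of_mem hvz (by simp)
  have hmid :
      midpoint ℝ v z ∈ interior (convexHull ℝ (↑ω : Set (EuclideanSpace ℝ (Fin 3)))) :=
    (convex_convexHull ℝ _).openSegment_interior_self_subset_interior hvint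
      (subset_convexHull ℝ _ (Finset.mem_coe.2 hzω)) (midpoint_mem_openSegment v z)
  -- each cell of `S` has exactly two vertices besides `v` and `z`
  have hcard : ∀ t ∈ S, ((t.erase v).erase z).card = 2 := by
    intro t ht
    obtain ⟨-, hvt, hzt, hc⟩ := (hS t).1 ht
    rw [Finset.card_erase_of_mem (Finset.mem_erase.2 ⟨hzv, hzt⟩), Finset.card_erase_of_mem hvt,
      hc]
  -- enumerations `Fin n ≃ S` and `Fin 2 ≃ (t ∖ {v}) ∖ {z}`
  set n : ℕ := S.card
  set e : Fin n ≃ ↥S := S.equivFin.symm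
  have eR : ∀ t : ↥S, Fin 2 ≃ ↥(((t : Finset (EuclideanSpace ℝ (Fin 3))).erase v).erase z) :=
    fun t => (Finset.equivFinOfCardEq (hcard t t.2)).symm
  set p : Fin n → Fin 2 → EuclideanSpace ℝ (Fin 3) := fun k i =>
    ((eR (e k) i : ↥(((e k : Finset (EuclideanSpace ℝ (Fin 3))).erase v).erase z)) :
      EuclideanSpace ℝ (Fin 3)) with hp
  have hpmem : ∀ k i, p k i ∈ ((e k : Finset (EuclideanSpace ℝ (Fin 3))).erase v).erase z :=
    fun k i => (eR (e k) i).2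
  -- the wedge of a cell, reindexed by `Fin 2`
  have hW : ∀ k, F (e k : Finset (EuclideanSpace ℝ (Fin 3))) =
      ballFraction v (apexWedge v (z - v) (fun i => p k i - v)) := by
    intro k
    simp only [hF, hp]
    rw [← apexWedge_comp_equiv v (z - v)
      (fun w : ↥(((e k : Finset (EuclideanSpace ℝ (Fin 3))).erase v).erase z) =>
        (w : EuclideanSpace ℝ (Fin 3)) - v) (eR (e k))]
    rfl
  -- the vertex set of a cell, reindexed
  have hunion : ∀ k, {v, z} ∪ Set.range (p k) =
      ((e k : Finset (EuclideanSpace ℝ (Fin 3))) : Set (EuclideanSpace ℝ (Fin 3))) := by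
    intro k
    obtain ⟨-, hvt, hzt, -⟩ := (hS _).1 (e k).2
    ext x
    simp only [Set.mem_union, Set.mem_insert_iff, Set.mem_singleton_iff, Set.mem_range,
      Finset.mem_coe]
    constructor
    · rintro ((rfl | rfl) | ⟨i, rfl⟩)
      · exact hvt
      · exact hzt
      · exact Finset.mem_of_mem_erase (Finset.mem_of_mem_erase (hpmem k i))
    · intro hx
      by_cases hxv : x = v
      · exact Or.inl (Or.inl hxv)
      by_cases hxz : x = z
      · exact Or.inl (Or.inr hxz)
      refine Or.inr ⟨(eR (e k)).symm ⟨x, Finset.mem_erase.2 ⟨hxz,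
        Finset.mem_erase.2 ⟨hxv, hx⟩⟩⟩, ?_⟩
      simp only [hp, Equiv.apply_symm_apply]
  -- (1) non-degeneracy
  have hli : ∀ k, LinearIndependent ℝ ![z - v, p k 0 - v, p k 1 - v] := by
    intro k
    obtain ⟨ht, hvt, hzt, -⟩ := (hS _).1 (e k).2
    refine linearIndependent_edge_vectors ht hvt (Finset.mem_erase.2 ⟨hzv, hzt⟩) (hpmem k 0)
      (hpmem k 1) ?_
    intro h01
    have : (eR (e k) 0) = (eR (e k) 1) := Subtype.ext h01
    exact absurd ((eR (e k)).injective this) (by decide)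
  -- (2) disjoint interiors
  have hdisj : ∀ k l, k ≠ l → interior (convexHull ℝ ({v, z} ∪ Set.range (p k))) ∩
      interior (convexHull ℝ ({v, z} ∪ Set.range (p l))) = ∅ := by
    intro k l hkl
    rw [hunion k, hunion l, ← Set.disjoint_iff_inter_eq_empty]
    refine disjoint_interior_convexHull K ((hS _).1 (e k).2).1 ((hS _).1 (e l).2).1 ?_
    intro hkl'
    exact hkl (e.injective (Subtype.ext hkl'))
  -- (3) the cells cover a ball about the midpoint
  have h4 : Module.finrank ℝ (EuclideanSpace ℝ (Fin 3)) + 1 = 4 := by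
    rw [finrank_euclideanSpace_fin]
  obtain ⟨r, hr, hball⟩ :=
    hK.exists_ball_subset_biUnion_edgeStar ω.finite_toSet hzv.symm hvz hmid
  have hcover : ∃ r : ℝ, 0 < r ∧
      Metric.ball (midpoint ℝ v z) r ⊆ ⋃ k, convexHull ℝ ({v, z} ∪ Set.range (p k)) := by
    refine ⟨r, hr, fun x hx => ?_⟩
    obtain ⟨t, ht, hxt⟩ := Set.mem_iUnion₂.1 (hball hx)
    rw [mem_edgeStar, h4] at ht
    have htS : t ∈ S := (hS t).2 ht
    refine Set.mem_iUnion.2 ⟨e.symm ⟨t, htS⟩, ?_⟩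
    rw [hunion, Equiv.apply_symm_apply]
    exact hxt
  -- apply `DihedralFlatness` and transport the sum back to `S`
  have hflat : ∑ k : Fin n, ballFraction v (apexWedge v (z - v) (fun i => p k i - v)) = 1 :=
    (dihedralFlatness_proof n v z p hli hdisj).2 hcover
  calc ∑ t ∈ S, F t = ∑ t : ↥S, F (t : Finset (EuclideanSpace ℝ (Fin 3))) :=
        (Finset.sum_coe_sort S F).symm
    _ = ∑ k : Fin n, F (e k : Finset (EuclideanSpace ℝ (Fin 3))) :=
        (e.sum_comp (fun t : ↥S => F (t : Finset (EuclideanSpace ℝ (Fin 3))))).symm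
    _ = ∑ k : Fin n, ballFraction v (apexWedge v (z - v) (fun i => p k i - v)) :=
        Fintype.sum_congr _ _ hW
    _ = 1 := hflat

end Summit.AtomisticToContinuum.Crystallization.Theorems.ParFiveRecountEdgeFlat

end
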